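import Literature.AlgebraicGeometry.GroupSchemes.BarsottiTateGroupConnectedPartTangent   -- ★ p845988 (B-p08): `isIdempotentElem_ker_appTop_of_isOpenImmersion_of_surjective`
import Literature.AlgebraicGeometry.GroupSchemes.HopfIdealOfClosedSubgroup               -- ★ `isHopfIdeal_ker_appTop`
import Literature.AlgebraicGeometry.GroupSchemes.UnitComponentRank                       -- ★ `free_alg_of_flat`
import Literature.AlgebraicGeometry.GroupSchemes.UnitComponentOfFiniteGroupScheme         -- ★ `isFinite_and_flat_of_immersions`
import Literature.AlgebraicGeometry.GroupSchemes.ConnectedFactorsThroughUnitComponent    -- ★ (o-c2d) `existsUnique_fac_hom`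
import Mathlib.RingTheory.Ideal.IdempotentFG
import HarnessLib

/-!
# The ideal of a unit component over a local base: `ker Γ(G⁰ ↪ G) = (1 − e)`, Hopf, with free quotient, stable under every endomorphism
# ([Tate 1997] (3.7); [Serre–Tate 1968] §1; [Stacks 04PS])

Topic `Literature/AlgebraicGeometry/GroupSchemes`; namespace `Literature.AlgebraicGeometry.GroupSchemes.UnitComponentIdeal`.  THEOREMS ONLY; no
definition, no named fact, no instance, no notation, no `sorry`.  Cell `hodgecm-mathlib` (D-0151), P6 «MOD programme», F0P6c-plan (g2) DICT deal
(D7) «(b4′-A) CANONICAL-LINE ASSEMBLY IN CONSTRUCTOR CURRENCY» (2026-09-01 17:23Z), FILE A: the UNIT-COMPONENT IDEAL OVER THE BASE `R` in the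
currency of ★ (D4) `Literature.RingTheory.Flat.existsUnique_hopfIdeal_closure_le_sup` (which asks for `I₀ = span {1 − e}`, `I₀` Hopf, `A ⧸ I₀` free).
HC_CM is proved only modulo the printed citations until rung 0 closes; nothing here is about HC.

THE PRINT.  [Tate1997FiniteFlatGroupSchemes] (3.7) (I): over a henselian local ring the unit component `G⁰` of a finite flat group scheme
`G = Spec A` is the open-and-closed subgroup `Spec A⁰`, `A = A⁰ × A'`, cut out by an idempotent; `A⁰ = A ⧸ (1 − e)` is finite flat (free over
local `R`).  Every endomorphism of `G` maps the connected `G⁰` into `G⁰`.  HERE, for an affine group `G` over ANY commutative ring `R` and a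
homomorphism `j : U ↪ G` whose underlying morphism is an open-and-closed immersion: `Γ(j) : Γ(G) ↠ Γ(U)` is surjective with IDEMPOTENT kernel
`I₀` (★ `isIdempotentElem_ker_appTop_of_isOpenImmersion_of_surjective`: flat + surjective ⇒ pure, [Stacks 04PS]); `I₀` is a Hopf ideal (★
`isHopfIdeal_ker_appTop`); when `G → Spec R` is finite flat over LOCAL `R`, `Γ(U)` is free, `I₀` is finitely generated, hence `I₀ = (1 − e)` for an
idempotent `e` (Mathlib `Ideal.isIdempotentElem_iff_of_fg`), and `Γ(G) ⧸ I₀ ≅ Γ(U)` is free of the same rank; when `U` is CONNECTED, every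
endomorphism `φ` of `G` satisfies `φ ∘ j = j ∘ ψ` (★ (o-c2d) `existsUnique_fac_hom`), so `Γ(φ)(I₀) ⊆ I₀`.

MAIN STATEMENTS.  `surjective_comap`, `isIdempotentElem_ker_comap`, `isHopfIdeal_ker_comap`, `nonempty_quotient_ker_comap_algEquiv`, `free_alg_unitComponent`,
`free_quotient_ker_comap`, `finrank_quotient_ker_comap_eq`, `fg_ker_comap`, **`exists_isIdempotentElem_ker_comap_eq_span`**, **`map_ker_comap_le_of_hom`**.

## References
* [Tate1997FiniteFlatGroupSchemes] J. Tate, *Finite flat group schemes*, in: Modular Forms and Fermat's Last Theorem (1997), (3.7) (I), p. 141.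
* [SerreTate1968] J.-P. Serre, J. Tate, *Good reduction of abelian varieties*, Ann. of Math. 88 (1968), §1 Lemma 1.
* [StacksProject] The Stacks Project, Tag 04PS (pure ideals), Tag 00EC (idempotents and clopen subsets).
-/

set_option autoImplicit false

noncomputable section

universe u

open CategoryTheory CategoryTheory.Limits AlgebraicGeometry MonoidalCategory CartesianMonoidalCategory
open scoped MonObj

namespace Literature.AlgebraicGeometry.GroupSchemes.UnitComponentIdeal

open Literature.AlgebraicGeometry.Motives (SchemeOver)
open Literature.AlgebraicGeometry.GroupSchemes.AffineGroupScheme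

variable {R : Type u} [CommRing R] (G U : SchemeOver R) (j : U ⟶ G)

/-! ## §1 `Γ(j)` is surjective with idempotent Hopf kernel -/

/-- `Γ(j) : Γ(G) → Γ(U)` is SURJECTIVE for a closed immersion `j` into an affine scheme. [cite: Tate1997FiniteFlatGroupSchemes, (3.7)] -/
theorem surjective_comap [IsAffine G.left] [IsClosedImmersion j.left] : Function.Surjective (Alg.comap j) :=
  (IsClosedImmersion.isAffine_surjective_of_isAffine j.left).2

/-- The kernel `I₀ = ker Γ(j)` of an OPEN-AND-CLOSED immersion of affine schemes is IDEMPOTENT, `I₀ = I₀²`. [cite: StacksProject, Tag 04PS] -/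
theorem isIdempotentElem_ker_comap [IsAffine G.left] [IsAffine U.left] [IsOpenImmersion j.left] [IsClosedImmersion j.left] :
    IsIdempotentElem (RingHom.ker (Alg.comap j).toRingHom) :=
  isIdempotentElem_ker_appTop_of_isOpenImmersion_of_surjective j.left (surjective_comap G U j)

/-- `I₀ = ker Γ(j)` is a HOPF ideal when `j` is a homomorphic closed immersion (★ `isHopfIdeal_ker_appTop`). [cite: Tate1997FiniteFlatGroupSchemes, (3.7)] -/
theorem isHopfIdeal_ker_comap [IsAffine G.left] [IsAffine U.left] [GrpObj G] [GrpObj U] [IsMonHom j] [IsClosedImmersion j.left] :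
    (RingHom.ker (Alg.comap j).toRingHom : Ideal (Alg G)).IsHopfIdeal R :=
  isHopfIdeal_ker_appTop j

/-- `Γ(G) ⧸ I₀ ≅ Γ(U)` as `R`-algebras. [cite: Tate1997FiniteFlatGroupSchemes, (3.7)] -/
theorem nonempty_quotient_ker_comap_algEquiv [IsAffine G.left] [IsClosedImmersion j.left] :
    Nonempty ((Alg G ⧸ (RingHom.ker (Alg.comap j).toRingHom : Ideal (Alg G))) ≃ₐ[R] Alg U) :=
  ⟨Ideal.quotientKerAlgEquivOfSurjective (surjective_comap G U j)⟩

/-! ## §2 Over a local base with `G` finite flat: `Γ(U)` free, `I₀ = (1 − e)` -/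

/-- `Γ(U)` is a FREE `R`-module of finite rank when `G → Spec R` is finite flat over local `R` and `j` an open-and-closed immersion (`U` is then finite
flat; ★ `free_alg_of_flat`). [cite: Tate1997FiniteFlatGroupSchemes, (3.7)] -/
theorem free_alg_unitComponent [IsAffine U.left] [IsLocalRing R] [GrpObj U] [IsFinite G.hom] [Flat G.hom] [IsOpenImmersion j.left] [IsClosedImmersion j.left] :
    Module.Free R (Alg U) := by
  haveI : IsFinite U.hom := (isFinite_and_flat_of_immersions j).1
  haveI : Flat U.hom := (isFinite_and_flat_of_immersions j).2 inferInstance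
  exact free_alg_of_flat U

/-- `Γ(G) ⧸ I₀` is FREE (it is `≅ Γ(U)`). [cite: Tate1997FiniteFlatGroupSchemes, (3.7)] -/
theorem free_quotient_ker_comap [IsAffine G.left] [IsAffine U.left] [IsLocalRing R] [GrpObj U] [IsFinite G.hom] [Flat G.hom] [IsOpenImmersion j.left]
    [IsClosedImmersion j.left] :
    Module.Free R (Alg G ⧸ (RingHom.ker (Alg.comap j).toRingHom : Ideal (Alg G))) := by
  haveI := free_alg_unitComponent G U j
  exact Module.Free.of_equiv (Ideal.quotientKerAlgEquivOfSurjective (surjective_comap G U j)).toLinearEquiv.symm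

/-- `rank_R (Γ(G) ⧸ I₀) = rank_R Γ(U)`. [cite: Tate1997FiniteFlatGroupSchemes, (3.7)] -/
theorem finrank_quotient_ker_comap_eq [IsAffine G.left] [IsClosedImmersion j.left] :
    Module.finrank R (Alg G ⧸ (RingHom.ker (Alg.comap j).toRingHom : Ideal (Alg G))) = Module.finrank R (Alg U) :=
  (Ideal.quotientKerAlgEquivOfSurjective (surjective_comap G U j)).toLinearEquiv.finrank_eq

/-- `I₀` is FINITELY GENERATED (the surjection `Γ(G) ↠ Γ(U)` onto a free module splits, so `I₀` is a direct summand of the finite `R`-module `Γ(G)`).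
[cite: Tate1997FiniteFlatGroupSchemes, (3.7)] -/
theorem fg_ker_comap [IsAffine G.left] [IsAffine U.left] [IsLocalRing R] [GrpObj U] [IsFinite G.hom] [Flat G.hom] [IsOpenImmersion j.left]
    [IsClosedImmersion j.left] :
    (RingHom.ker (Alg.comap j).toRingHom : Ideal (Alg G)).FG := by
  haveI : Module.Finite R (Alg G) := Alg.moduleFinite G
  haveI := free_alg_unitComponent G U j
  -- a splitting `s` of the `R`-linear surjection `Γ(j)`
  obtain ⟨s, hs⟩ := Module.projective_lifting_property (Alg.comap j).toLinearMap LinearMap.id (surjective_comap G U j)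
  -- `I₀ = range (id − s ∘ Γ(j))` as an `R`-submodule
  refine Submodule.FG.of_restrictScalars R ?_
  have hrange : (RingHom.ker (Alg.comap j).toRingHom : Ideal (Alg G)).restrictScalars R =
      LinearMap.range (LinearMap.id - s ∘ₗ (Alg.comap j).toLinearMap) := by
    ext a
    simp only [Submodule.restrictScalars_mem, RingHom.mem_ker, LinearMap.mem_range, LinearMap.sub_apply,
      LinearMap.id_apply, LinearMap.comp_apply]
    constructor
    · intro ha
      refine ⟨a, ?_⟩
      have h0 : (Alg.comap j).toLinearMap a = 0 := ha
      rw [h0, map_zero, sub_zero]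
    · rintro ⟨b, rfl⟩
      have hsb : (Alg.comap j).toLinearMap (s ((Alg.comap j).toLinearMap b)) = (Alg.comap j).toLinearMap b := by
        have := LinearMap.congr_fun hs ((Alg.comap j).toLinearMap b)
        simpa only [LinearMap.comp_apply, LinearMap.id_apply] using this
      change (Alg.comap j).toLinearMap (b - s ((Alg.comap j).toLinearMap b)) = 0
      rw [map_sub, hsb, sub_self]
  rw [hrange, LinearMap.range_eq_map]
  exact Module.Finite.fg_top.map _

/-- **`I₀ = (1 − e)` FOR AN IDEMPOTENT `e`** (finitely generated idempotent ideals are principal idempotent, Mathlib `Ideal.isIdempotentElem_iff_of_fg`; we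
normalise the generator as `1 − e`, `e` the «unit idempotent»). [cite: StacksProject, Tag 00EC] [cite: Tate1997FiniteFlatGroupSchemes, (3.7)] -/
theorem exists_isIdempotentElem_ker_comap_eq_span [IsAffine G.left] [IsAffine U.left] [IsLocalRing R] [GrpObj U] [IsFinite G.hom] [Flat G.hom]
    [IsOpenImmersion j.left] [IsClosedImmersion j.left] :
    ∃ e : Alg G, IsIdempotentElem e ∧ (RingHom.ker (Alg.comap j).toRingHom : Ideal (Alg G)) = Ideal.span {1 - e} := by
  obtain ⟨e', he', h⟩ := ((RingHom.ker (Alg.comap j).toRingHom : Ideal (Alg G)).isIdempotentElem_iff_of_fg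
    (fg_ker_comap G U j)).mp (isIdempotentElem_ker_comap G U j)
  refine ⟨1 - e', he'.one_sub, ?_⟩
  rw [sub_sub_cancel]
  exact h

/-! ## §3 Every endomorphism preserves the unit component: `Γ(φ)(I₀) ⊆ I₀` -/

/-- **`Γ(φ)(I₀) ⊆ I₀` FOR EVERY ENDOMORPHISM `φ` of `G`** when `U` is CONNECTED and `j` a homomorphic open-and-closed immersion: `j ≫ φ` factors as
`ψ ≫ j` (★ (o-c2d) `existsUnique_fac_hom`), so `Γ(j)(Γ(φ) a) = Γ(ψ)(Γ(j) a) = 0` for `a ∈ I₀`. [cite: Tate1997FiniteFlatGroupSchemes, (3.7)] -/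
theorem map_ker_comap_le_of_hom [GrpObj G] [GrpObj U] [IsMonHom j] [IsOpenImmersion j.left] [IsClosedImmersion j.left]
    [ConnectedSpace ↥U.left] [Nonempty ↥(𝟙_ (SchemeOver R)).left] (φ : G ⟶ G) [IsMonHom φ] :
    (RingHom.ker (Alg.comap j).toRingHom : Ideal (Alg G)).map (Alg.comap φ).toRingHom ≤ RingHom.ker (Alg.comap j).toRingHom := by
  obtain ⟨ψ, hψ, -⟩ := existsUnique_fac_hom j (j ≫ φ)
  rw [Ideal.map_le_iff_le_comap]
  intro a ha
  rw [Ideal.mem_comap, RingHom.mem_ker]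
  rw [RingHom.mem_ker] at ha
  change (Alg.comap j) ((Alg.comap φ) a) = 0
  have h1 : (Alg.comap j) ((Alg.comap φ) a) = (Alg.comap (j ≫ φ)) a := by
    rw [Alg.comap_apply, Alg.comap_apply, Alg.comap_apply, Over.comp_left, Scheme.Hom.comp_appTop, CommRingCat.comp_apply]
  have h2 : (Alg.comap (j ≫ φ)) a = (Alg.comap ψ) ((Alg.comap j) a) := by
    rw [← hψ, Alg.comap_apply, Alg.comap_apply, Alg.comap_apply, Over.comp_left, Scheme.Hom.comp_appTop, CommRingCat.comp_apply]
  rw [h1, h2, show (Alg.comap j) a = 0 from ha, map_zero]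

end Literature.AlgebraicGeometry.GroupSchemes.UnitComponentIdeal

end
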